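import Mathlib
import Literature.NumberTheory.NumberFields.InertiaGeneratesGalois
import Literature.NumberTheory.NumberFields.PureCubicClassNumberModThreeProofs
import HarnessLib

/-!
# Crux `LinnikCubicClassGroups.PureCubicClassNumberHard` (stmt-QuantumAdvantage-11826) —
# stub `stub_unramifiedOutside`

Line `Sketch` (honda-leak arm), stub `stub_unramifiedOutside` (L): **`N / ℚ(ζ₃)` is unramified
outside `pq`** for the degree-`6` Galois field `N ∋ ζ, θ` (`ζ² + ζ + 1 = 0`, `θ³ = pq`, so
`N = ℚ(ζ, ∛(pq))` is the Galois closure of the pure cubic field `ℚ(∛(pq))`), `p ≠ q` primes with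
`pq ≡ ±1 (mod 9)`: every maximal ideal `w` of `𝓞 N` with `p, q ∉ w` has ramification index
`e(w | w ∩ ℚ(ζ)) = 1`.

Proof (inertia groups in `G = Gal(N/ℚ)`, `#G = 6`, `H = Gal(N/ℚ(ζ))`, `#H = 3`; tree:
`card_inertia_eq_ramificationIdx(_int)`, `inertiaDeg_eq_one_of_inertia_eq_top` of
`Literature/NumberTheory/NumberFields/InertiaGeneratesGalois.lean`).  `e(w | ℚ(ζ)) = #I_H(w)`
divides `3`; suppose it is `3`, i.e. `H ≤ I(w)`.  Some `σ ∈ H` moves `θ` (`θ ∉ ℚ(ζ)` by degrees),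
so `σθ ∈ {ζθ, ζ²θ}` and `σθ − θ ∈ w` gives `3θ = ∓(1 − ζ^{∓1})(σθ − θ) ∈ w`; `θ ∈ w` would put
`p` or `q` in `w`, hence `3 ∈ w`.  Now `e(w | 3) = #I(w)` is divisible by `#H = 3`, divides
`#G = 6`, and is even (`3 = −ζ²(1 − ζ)²`), so `e(w | 3) = 6 = [N : ℚ]`: `w` is the only prime above
`3`, `v_w(3) = 6`, `v_w(1 − ζ) = 3`.  With `m = ±pq ≡ 1 (mod 9)` and `θ₀ = ±θ`:
`v_w((θ₀ − 1)(θ₀ − ζ)(θ₀ − ζ²)) = v_w(m − 1) ≥ 12`, while two of the three factors with valuation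
`≥ 4` would differ by a unit multiple of `1 − ζ`, of valuation `3`; hence one factor has valuation
`≥ 6 = v_w(3)`, i.e. `y = (θ₁ − 1)/3 ∈ 𝓞 N` for a cube root `θ₁ ∈ {θ₀, ζθ₀, ζ²θ₀}` of `m`.  But
the minimal polynomial of `y` is `X³ + X² + X/3 + (1 − m)/27 ∉ ℤ[X]` — contradiction.  (This is the
elementary content of Hecke's criterion "`ℚ(ζ₃, ∛m)/ℚ(ζ₃)` is unramified at `λ = 1 − ζ₃` when
`m ≡ ±1 (mod 9)`"; for the primes `ℓ ∤ 3pq` no input beyond `σθ − θ ∈ w ⟹ 3θ ∈ w` is needed.)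

Helpers carry the prefix `unrOut_`; `pq` is not a cube, `minpoly ∛(pq)` and `w ∩ ℤ = 3ℤ` come from
`Honda1971` (`PureCubicClassNumberModThreeProofs.lean`).
-/

set_option linter.dupNamespace false

noncomputable section

namespace Summit.QuantumAdvantage.QuantumAdvantage.Theorems.LinnikCubicClassGroups

open Polynomial NumberField IsDedekindDomain
open Literature.NumberTheory.NumberFields (Honda1971.pow_three_ne Honda1971.minpoly_eq
  Honda1971.under_int_eq_span card_inertia_eq_ramificationIdx card_inertia_eq_ramificationIdx_int
  inertiaDeg_eq_one_of_inertia_eq_top)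
open scoped IntermediateField

/-- A root of `X² + X + 1` in characteristic `0` is a primitive cube root of unity. [folklore] -/
theorem unrOut_isPrimitiveRoot {N : Type*} [Field N] [CharZero N] {ζ : N}
    (hζ : ζ ^ 2 + ζ + 1 = 0) : IsPrimitiveRoot ζ 3 := by
  -- adapted from the line skeleton (`isPrimitiveRoot_of_sq_add_eq_zero`)
  haveI : Fact (Nat.Prime 3) := ⟨Nat.prime_three⟩
  have h3 : ζ ^ 3 = 1 := by linear_combination (ζ - 1) * hζ
  have h1 : ζ ≠ 1 := by rintro rfl; norm_num at hζ
  rw [← orderOf_eq_prime h3 h1]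
  exact IsPrimitiveRoot.orderOf ζ

/-- `[ℚ(ζ) : ℚ] = 2` for `ζ² + ζ + 1 = 0`: the minimal polynomial of `ζ` is `Φ₃`, of degree
`φ(3) = 2`. [folklore] -/
theorem unrOut_finrank_adjoin_eq_two {N : Type*} [Field N] [CharZero N] {ζ : N}
    (hζ : ζ ^ 2 + ζ + 1 = 0) : Module.finrank ℚ ℚ⟮ζ⟯ = 2 := by
  have h3 := unrOut_isPrimitiveRoot hζ
  have hint : IsIntegral ℚ ζ := (h3.isIntegral (by norm_num)).tower_top
  rw [IntermediateField.adjoin.finrank hint, ← cyclotomic_eq_minpoly_rat h3 (by norm_num),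
    natDegree_cyclotomic, Nat.totient_prime Nat.prime_three]

/-- If `(3y + 1)³ = m` with `m ∈ ℤ` not a rational cube, then `y` is not integral over `ℤ`: its
minimal polynomial over `ℚ` is the irreducible cubic `X³ + X² + X/3 + (1 − m)/27`, whose
`X`-coefficient `1/3` is not an integer. [folklore] -/
theorem unrOut_not_isIntegral {N : Type*} [Field N] [CharZero N] {m : ℤ}
    (hcube : ∀ b : ℚ, b ^ 3 ≠ (m : ℚ)) {y : N} (hy : (3 * y + 1) ^ 3 = (m : N)) :
    ¬ IsIntegral ℤ y := by
  intro hint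
  set g : ℚ[X] := X ^ 3 + X ^ 2 + C (1 / 3 : ℚ) * X + C ((1 - m) / 27 : ℚ) with hgdef
  have hmonic : g.Monic := by rw [hgdef]; monicity!
  have hdeg : g.natDegree = 3 := by rw [hgdef]; compute_degree!
  have haeval : aeval y g = 0 := by
    simp only [hgdef, map_add, map_mul, aeval_X_pow, aeval_X, aeval_C, eq_ratCast]
    push_cast
    linear_combination hy / 27
  have hirr : Irreducible g := by
    refine irreducible_of_degree_le_three_of_not_isRoot (by rw [hdeg]; decide) fun r hr => ?_
    apply hcube (3 * r + 1)
    have hr' : r ^ 3 + r ^ 2 + 1 / 3 * r + (1 - m) / 27 = 0 := by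
      have h := hr
      simp only [hgdef, IsRoot.def, eval_add, eval_mul, eval_pow, eval_X, eval_C] at h
      linear_combination h
    linear_combination 27 * hr'
  have hmin : minpoly ℚ y = g := (minpoly.eq_of_irreducible_of_monic hirr haeval hmonic).symm
  have hZ := minpoly.isIntegrallyClosed_eq_field_fractions' ℚ hint
  rw [hmin] at hZ
  have hc := congrArg (fun f : ℚ[X] => f.coeff 1) hZ
  simp only [hgdef, coeff_add, coeff_X_pow, coeff_C_mul, coeff_X_one, coeff_C, coeff_map,
    eq_intCast] at hc
  norm_num at hc
  have h3 : (3 : ℚ) * ((minpoly ℤ y).coeff 1 : ℚ) = 1 := by rw [← hc]; norm_num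
  have h3' : (3 : ℤ) * (minpoly ℤ y).coeff 1 = 1 := by exact_mod_cast h3
  omega

/-- **Valuations of `θ − 1, θ − ζ, θ − ζ²` at a prime with `v(3) = 6`, `v(1 − ζ) = 3`.**  In a
Dedekind domain `R ∋ ζ` (`ζ² + ζ + 1 = 0`) of characteristic `0`, let `v` be a prime with
`v(3) = 6`, `v(1 − ζ) = 3` (additively) and `θ³ = m ∈ ℤ`, `9 ∣ m − 1`, `m` not a rational cube.
Then some cube root `θ₁ ∈ {θ, ζ²θ, ζθ}` of `m` has `v(θ₁ − 1) ≥ v(3)`: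
`v((θ − 1)(θ − ζ)(θ − ζ²)) = v(m − 1) ≥ 12`, while two factors of valuation `≥ 4` would differ
by a unit multiple of `1 − ζ`, of valuation `3`; so one factor has valuation `≥ 6`. [folklore] -/
theorem unrOut_exists_cubeRoot_val_le {R : Type*} [CommRing R] [IsDedekindDomain R] [CharZero R]
    (v : HeightOneSpectrum R) {ζ θ : R} (hζ : ζ ^ 2 + ζ + 1 = 0) {m : ℤ} (hm : (9 : ℤ) ∣ m - 1)
    (hcube : ∀ b : ℚ, b ^ 3 ≠ (m : ℚ)) (hθ : θ ^ 3 = (m : R))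
    (hv3 : v.intValuation (3 : R) = WithZero.exp (-6))
    (hvl : v.intValuation (1 - ζ) = WithZero.exp (-3)) :
    ∃ θ₁ : R, θ₁ ^ 3 = (m : R) ∧ v.intValuation (θ₁ - 1) ≤ v.intValuation (3 : R) := by
  classical
  have hζ3 : ζ ^ 3 = 1 := by linear_combination (ζ - 1) * hζ
  have hζv : ζ ∉ v.asIdeal := fun h =>
    v.isPrime.ne_top ((Ideal.eq_top_iff_one _).mpr
      (hζ3 ▸ v.asIdeal.pow_mem_of_mem h 3 (by norm_num)))
  have hvζ : v.intValuation ζ = 1 := HeightOneSpectrum.intValuation_eq_one_iff.mpr hζv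
  have hv1ζ : v.intValuation (1 + ζ) = 1 := by
    rw [show (1 + ζ : R) = -ζ ^ 2 by linear_combination hζ, Valuation.map_neg, map_pow, hvζ,
      one_pow]
  have hne : ∀ u : R, u ^ 3 = 1 → θ - u ≠ 0 := by
    intro u hu h
    have hm1 : (m : R) = ((1 : ℤ) : R) := by rw [← hθ, sub_eq_zero.mp h, hu, Int.cast_one]
    exact hcube 1 (by rw [Int.cast_injective hm1]; norm_num)
  have h1 : θ - 1 ≠ 0 := hne 1 (one_pow 3)
  have h2 : θ - ζ ≠ 0 := hne ζ hζ3
  have h3 : θ - ζ ^ 2 ≠ 0 := hne (ζ ^ 2) (by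
    calc (ζ ^ 2) ^ 3 = (ζ ^ 3) ^ 2 := by ring
      _ = 1 := by rw [hζ3, one_pow])
  set a := multiplicity v.asIdeal (Ideal.span {θ - 1}) with ha_def
  set b := multiplicity v.asIdeal (Ideal.span {θ - ζ}) with hb_def
  set c := multiplicity v.asIdeal (Ideal.span {θ - ζ ^ 2}) with hc_def
  have ha : v.intValuation (θ - 1) = WithZero.exp (-(a : ℤ)) :=
    v.intValuation_eq_exp_neg_multiplicity h1
  have hb : v.intValuation (θ - ζ) = WithZero.exp (-(b : ℤ)) :=
    v.intValuation_eq_exp_neg_multiplicity h2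
  have hc : v.intValuation (θ - ζ ^ 2) = WithZero.exp (-(c : ℤ)) :=
    v.intValuation_eq_exp_neg_multiplicity h3
  have hsum : 12 ≤ a + b + c := by
    obtain ⟨k, hk⟩ := hm
    have hk' : (m : R) - 1 = 9 * (k : R) := by exact_mod_cast congrArg (fun z : ℤ => (z : R)) hk
    have hprod : (θ - 1) * (θ - ζ) * (θ - ζ ^ 2) = 3 * 3 * (k : R) := by
      linear_combination hθ + hk' - (θ ^ 2 - ζ * θ + ζ - 1) * hζ
    have hle : v.intValuation ((θ - 1) * (θ - ζ) * (θ - ζ ^ 2)) ≤ WithZero.exp (-12) := by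
      rw [hprod, map_mul, map_mul, hv3, ← WithZero.exp_add]
      calc WithZero.exp (-6 + -6) * v.intValuation (k : R)
          ≤ WithZero.exp (-6 + -6) * 1 := mul_le_mul_right (v.intValuation_le_one _) _
        _ = WithZero.exp (-12) := by rw [mul_one]; norm_num
    rw [map_mul, map_mul, ha, hb, hc, ← WithZero.exp_add, ← WithZero.exp_add,
      WithZero.exp_le_exp] at hle
    omega
  have hab : a ≤ 3 ∨ b ≤ 3 := by
    have h := Valuation.map_sub v.intValuation (θ - 1) (θ - ζ)
    rw [show θ - 1 - (θ - ζ) = -(1 - ζ) by ring, Valuation.map_neg, hvl, ha, hb, le_max_iff,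
      WithZero.exp_le_exp, WithZero.exp_le_exp] at h
    omega
  have hbc : b ≤ 3 ∨ c ≤ 3 := by
    have h := Valuation.map_sub v.intValuation (θ - ζ) (θ - ζ ^ 2)
    rw [show θ - ζ - (θ - ζ ^ 2) = -(ζ * (1 - ζ)) by ring, Valuation.map_neg, map_mul, hvζ,
      one_mul, hvl, hb, hc, le_max_iff, WithZero.exp_le_exp, WithZero.exp_le_exp] at h
    omega
  have hac : a ≤ 3 ∨ c ≤ 3 := by
    have h := Valuation.map_sub v.intValuation (θ - 1) (θ - ζ ^ 2)
    rw [show θ - 1 - (θ - ζ ^ 2) = -((1 + ζ) * (1 - ζ)) by ring, Valuation.map_neg, map_mul,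
      hv1ζ, one_mul, hvl, ha, hc, le_max_iff, WithZero.exp_le_exp, WithZero.exp_le_exp] at h
    omega
  rcases (show 6 ≤ a ∨ 6 ≤ b ∨ 6 ≤ c by omega) with h | h | h
  · exact ⟨θ, hθ, by rw [ha, hv3, WithZero.exp_le_exp]; omega⟩
  · refine ⟨ζ ^ 2 * θ, ?_, ?_⟩
    · calc (ζ ^ 2 * θ) ^ 3 = (ζ ^ 3) ^ 2 * θ ^ 3 := by ring
        _ = (m : R) := by rw [hζ3, one_pow, one_mul, hθ]
    · rw [show ζ ^ 2 * θ - 1 = ζ ^ 2 * (θ - ζ) by linear_combination (ζ - 1) * hζ, map_mul,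
        map_pow, hvζ, one_pow, one_mul, hb, hv3, WithZero.exp_le_exp]
      omega
  · refine ⟨ζ * θ, ?_, ?_⟩
    · rw [mul_pow, hζ3, one_mul, hθ]
    · rw [show ζ * θ - 1 = ζ * (θ - ζ ^ 2) by linear_combination (ζ - 1) * hζ, map_mul, hvζ,
        one_mul, hc, hv3, WithZero.exp_le_exp]
      omega

/-- **No cube root `θ₁ ∈ 𝓞 N` of a non-cube `m` has `v_w(θ₁ − 1) ≥ v_w(3)` at a prime `w` which
is the only prime of `𝓞 N` above `3`**: then `y = (θ₁ − 1)/3` has all its valuations `≤ 1`, so is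
an algebraic integer (Mathlib `mem_integers_of_valuation_le_one`), contradicting
`unrOut_not_isIntegral`. [folklore] -/
theorem unrOut_false_of_val_le {N : Type*} [Field N] [NumberField N] {m : ℤ}
    (hcube : ∀ b : ℚ, b ^ 3 ≠ (m : ℚ)) (v : HeightOneSpectrum (𝓞 N))
    (huniq : ∀ v' : HeightOneSpectrum (𝓞 N), (3 : 𝓞 N) ∈ v'.asIdeal → v' = v)
    {θ₁ : 𝓞 N} (hθ₁ : θ₁ ^ 3 = (m : 𝓞 N))
    (hle : v.intValuation (θ₁ - 1) ≤ v.intValuation (3 : 𝓞 N)) : False := by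
  set y : N := (algebraMap (𝓞 N) N θ₁ - 1) / 3 with hydef
  have hy3 : (3 * y + 1) ^ 3 = (m : N) := by
    have h := congrArg (algebraMap (𝓞 N) N) hθ₁
    rw [map_pow, map_intCast] at h
    rw [← h, hydef]
    ring
  refine unrOut_not_isIntegral hcube hy3 ?_
  have hval : ∀ v' : HeightOneSpectrum (𝓞 N), v'.valuation N y ≤ 1 := by
    intro v'
    have hy' : y = algebraMap (𝓞 N) N (θ₁ - 1) / algebraMap (𝓞 N) N 3 := by
      rw [hydef, map_sub, map_one, map_ofNat]
    rw [hy', map_div₀, HeightOneSpectrum.valuation_of_algebraMap,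
      HeightOneSpectrum.valuation_of_algebraMap]
    by_cases h3 : (3 : 𝓞 N) ∈ v'.asIdeal
    · rw [huniq v' h3]
      exact div_le_one_of_le₀ hle zero_le
    · rw [HeightOneSpectrum.intValuation_eq_one_iff.mpr h3, div_one]
      exact v'.intValuation_le_one _
  obtain ⟨z, hz⟩ := HeightOneSpectrum.mem_integers_of_valuation_le_one N y hval
  exact hz ▸ RingOfIntegers.isIntegral_coe z

/-- **`N / ℚ(ζ₃)` is unramified outside `pq`** (`pq ≡ ±1 (mod 9)`).  For a Galois number field
`N` of degree `6` containing `ζ` (`ζ² + ζ + 1 = 0`) and `θ` (`θ³ = pq`, `p ≠ q` primes), every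
maximal ideal `w ∌ p, q` of `𝓞 N` has ramification index `1` over `𝓞 ℚ(ζ)`.  If
`e(w | ℚ(ζ)) = #I_{Gal(N/ℚ(ζ))}(w)` were `3`, an automorphism `σ` fixing `ζ` with `σθ = ζ^{±1}θ`
would be inertial at `w`, giving `3θ ∈ w`, so `3 ∈ w`; then `e(w | 3) = 6`, `v_w(3) = 6`,
`v_w(1 − ζ) = 3`, and the `λ`-adic step (`unrOut_exists_cubeRoot_val_le`, using `pq ≡ ±1 (mod 9)`)
produces a cube root `θ₁` of `m = ±pq` with `(θ₁ − 1)/3 ∈ 𝓞 N`, impossible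
(`unrOut_false_of_val_le`). [folklore] -/
theorem stub_unramifiedOutside (N : Type) [Field N] [NumberField N] [IsGalois ℚ N]
    (hN : Module.finrank ℚ N = 6) (p q : ℕ) (hp : p.Prime) (hq : q.Prime) (hpq : p ≠ q)
    (h9 : (p * q) % 9 = 1 ∨ (p * q) % 9 = 8)
    (ζ θ : N) (hζ : ζ ^ 2 + ζ + 1 = 0) (hθ : θ ^ 3 = ((p * q : ℕ) : N))
    (w : Ideal (𝓞 N)) [w.IsMaximal] (hpw : (p : 𝓞 N) ∉ w) (hqw : (q : 𝓞 N) ∉ w) :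
    w.ramificationIdx (𝓞 ℚ⟮ζ⟯) = 1 := by
  classical
  set F : IntermediateField ℚ N := ℚ⟮ζ⟯ with hFdef
  set H : Subgroup (N ≃ₐ[ℚ] N) := F.fixingSubgroup with hHdef
  haveI : IsGaloisGroup H F N := IsGaloisGroup.intermediateField (N ≃ₐ[ℚ] N) ℚ N F
  have hF2 : Module.finrank ℚ F = 2 := unrOut_finrank_adjoin_eq_two hζ
  have hFN : Module.finrank F N = 3 := by
    have h := Module.finrank_mul_finrank ℚ F N; rw [hF2, hN] at h; omega
  have hH3 : Nat.card H = 3 := by rw [hHdef, IsGalois.card_fixingSubgroup_eq_finrank, hFN]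
  have hG6 : Nat.card (N ≃ₐ[ℚ] N) = 6 := by rw [IsGalois.card_aut_eq_finrank, hN]
  have hcardI : Nat.card (w.inertia H) = w.ramificationIdx (𝓞 F) :=
    card_inertia_eq_ramificationIdx N H F w
  by_contra hne
  have hdvd : Nat.card (w.inertia H) ∣ 3 := hH3 ▸ Subgroup.card_subgroup_dvd_card _
  have hI3 : Nat.card (w.inertia H) = 3 := by
    rcases (Nat.dvd_prime Nat.prime_three).mp hdvd with h | h
    · exact absurd (hcardI ▸ h) hne
    · exact h
  have hItop : w.inertia H = ⊤ := Subgroup.eq_top_of_card_eq _ (by rw [hI3, hH3])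
  have hinert : ∀ σ : N ≃ₐ[ℚ] N, σ ∈ H → ∀ x : 𝓞 N, σ • x - x ∈ w := by
    intro σ hσ x
    have hmem : (⟨σ, hσ⟩ : H) ∈ w.inertia H := by rw [hItop]; exact Subgroup.mem_top _
    exact hmem x
  have hminθ : minpoly ℚ θ = X ^ 3 - C ((p * q : ℕ) : ℚ) := Honda1971.minpoly_eq hp hq hpq hθ
  have hθF : θ ∉ F := by
    intro hmem
    have h1 := minpoly.natDegree_le (A := ℚ) (⟨θ, hmem⟩ : F)
    have h2 : minpoly ℚ (⟨θ, hmem⟩ : F) = minpoly ℚ θ := by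
      rw [← minpoly.algebraMap_eq (algebraMap F N).injective (⟨θ, hmem⟩ : F)]
      rfl
    rw [h2, hminθ, natDegree_X_pow_sub_C, hF2] at h1
    omega
  obtain ⟨σ, hσH, hσθ⟩ : ∃ σ ∈ H, σ θ ≠ θ := by
    by_contra hall
    push Not at hall
    apply hθF
    have hfix : IntermediateField.fixedField H = F := IsGalois.fixedField_fixingSubgroup F
    rw [← hfix, IntermediateField.mem_fixedField_iff]
    exact hall
  have hζint : IsIntegral ℤ ζ := (unrOut_isPrimitiveRoot hζ).isIntegral (by norm_num)
  have hθint : IsIntegral ℤ θ := by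
    refine ⟨X ^ 3 - C ((p * q : ℕ) : ℤ), monic_X_pow_sub_C _ (by norm_num), ?_⟩
    simp [hθ]
  obtain ⟨ζ', hζ'c⟩ : ∃ x : 𝓞 N, algebraMap (𝓞 N) N x = ζ := ⟨⟨ζ, hζint⟩, rfl⟩
  obtain ⟨θ', hθ'c⟩ : ∃ x : 𝓞 N, algebraMap (𝓞 N) N x = θ := ⟨⟨θ, hθint⟩, rfl⟩
  have hζ'2 : ζ' ^ 2 + ζ' + 1 = 0 := by
    apply RingOfIntegers.coe_injective
    rw [map_add, map_add, map_pow, map_one, map_zero, hζ'c, hζ]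
  have hθ'3 : θ' ^ 3 = ((p * q : ℕ) : 𝓞 N) := by
    apply RingOfIntegers.coe_injective
    rw [map_pow, map_natCast, hθ'c, hθ]
  have hmem : σ • θ' - θ' ∈ w := hinert σ hσH θ'
  have hδ : algebraMap (𝓞 N) N (σ • θ') = σ (algebraMap (𝓞 N) N θ') := rfl
  have hσ3 : (σ θ) ^ 3 = θ ^ 3 := by rw [← map_pow, hθ, map_natCast]
  have hprod : (σ • θ' - θ') * ((σ • θ' - ζ' * θ') * (σ • θ' - ζ' ^ 2 * θ')) = 0 := by
    apply RingOfIntegers.coe_injective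
    simp only [map_mul, map_sub, map_pow, map_zero, hδ, hθ'c, hζ'c]
    linear_combination hσ3 + (σ θ - θ) * θ * ((ζ - 1) * θ - σ θ) * hζ
  have hne' : σ • θ' - θ' ≠ 0 := by
    intro h0
    apply hσθ
    have h1 := congrArg (algebraMap (𝓞 N) N) (sub_eq_zero.mp h0)
    rwa [hδ, hθ'c] at h1
  have h2 : (σ • θ' - ζ' * θ') * (σ • θ' - ζ' ^ 2 * θ') = 0 :=
    (mul_eq_zero.mp hprod).resolve_left hne'
  have h3θ : (3 : 𝓞 N) * θ' ∈ w := by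
    rcases mul_eq_zero.mp h2 with h | h
    · have heq : (3 : 𝓞 N) * θ' = -(1 - ζ' ^ 2) * (σ • θ' - θ') := by
        rw [sub_eq_zero.mp h]
        linear_combination θ' * (2 - ζ') * hζ'2
      exact heq ▸ w.mul_mem_left _ hmem
    · have heq : (3 : 𝓞 N) * θ' = -(1 - ζ') * (σ • θ' - θ') := by
        rw [sub_eq_zero.mp h]
        linear_combination θ' * (2 - ζ') * hζ'2
      exact heq ▸ w.mul_mem_left _ hmem
  have h3w : (3 : 𝓞 N) ∈ w := by
    refine ((Ideal.IsMaximal.isPrime inferInstance).mem_or_mem h3θ).resolve_right fun h => ?_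
    have hpq' : ((p : 𝓞 N) * (q : 𝓞 N)) ∈ w := by
      have := w.pow_mem_of_mem h 3 (by norm_num)
      rw [hθ'3] at this
      exact_mod_cast this
    exact ((Ideal.IsMaximal.isPrime inferInstance).mem_or_mem hpq').elim hpw hqw
  have hHle : H ≤ w.inertia (N ≃ₐ[ℚ] N) := fun τ hτ => hinert τ hτ
  have heI : Nat.card (w.inertia (N ≃ₐ[ℚ] N)) = w.ramificationIdx ℤ :=
    card_inertia_eq_ramificationIdx_int N (N ≃ₐ[ℚ] N) w
  have h3e : 3 ∣ w.ramificationIdx ℤ := by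
    rw [← heI, ← hH3]; exact Subgroup.card_dvd_of_le hHle
  have he6 : w.ramificationIdx ℤ ∣ 6 := by
    rw [← heI, ← hG6]; exact Subgroup.card_subgroup_dvd_card _
  have hw0 : w ≠ ⊥ := Ideal.IsMaximal.ne_bot_of_isIntegral_int w
  let v : HeightOneSpectrum (𝓞 N) := ⟨w, Ideal.IsMaximal.isPrime inferInstance, hw0⟩
  set P3 : Ideal ℤ := Ideal.span {((3 : ℕ) : ℤ)} with hP3def
  have hunder : w.under ℤ = P3 :=
    Honda1971.under_int_eq_span Nat.prime_three v (by exact_mod_cast h3w)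
  haveI : w.LiesOver P3 := ⟨hunder.symm⟩
  have hP3map : P3.map (algebraMap ℤ (𝓞 N)) = Ideal.span {(3 : 𝓞 N)} := by
    rw [hP3def, Ideal.map_span, Set.image_singleton, map_natCast, Nat.cast_ofNat]
  have h30 : (3 : 𝓞 N) ≠ 0 := by exact_mod_cast (by norm_num : (3 : ℕ) ≠ 0)
  have hmap0 : P3.map (algebraMap ℤ (𝓞 N)) ≠ ⊥ := by
    rw [hP3map, Ne, Ideal.span_singleton_eq_bot]; exact h30
  have hemult : w.ramificationIdx ℤ = multiplicity w (Ideal.span {(3 : 𝓞 N)}) := by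
    rw [Ideal.IsDedekindDomain.ramificationIdx_eq_multiplicity P3 w hmap0, hP3map]
  have hv3 : v.intValuation (3 : 𝓞 N) = WithZero.exp (-(w.ramificationIdx ℤ : ℤ)) := by
    rw [hemult]; exact v.intValuation_eq_exp_neg_multiplicity h30
  have hl0 : (1 - ζ' : 𝓞 N) ≠ 0 := by
    intro h
    rw [← (sub_eq_zero.mp h)] at hζ'2
    norm_num at hζ'2
  set t : ℕ := multiplicity w (Ideal.span {(1 - ζ' : 𝓞 N)}) with htdef
  have hvl : v.intValuation (1 - ζ') = WithZero.exp (-(t : ℤ)) :=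
    v.intValuation_eq_exp_neg_multiplicity hl0
  have hζ'3 : ζ' ^ 3 = 1 := by linear_combination (ζ' - 1) * hζ'2
  have hζ'w : ζ' ∉ w := fun h =>
    (Ideal.IsMaximal.isPrime inferInstance).ne_top ((Ideal.eq_top_iff_one _).mpr
      (hζ'3 ▸ w.pow_mem_of_mem h 3 (by norm_num)))
  have hvζ : v.intValuation ζ' = 1 := HeightOneSpectrum.intValuation_eq_one_iff.mpr hζ'w
  have h3eq : (3 : 𝓞 N) = -ζ' ^ 2 * (1 - ζ') ^ 2 := by
    linear_combination (ζ' ^ 2 - 3 * ζ' + 3) * hζ'2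
  have he2t : (w.ramificationIdx ℤ : ℤ) = 2 * t := by
    have h := hv3
    rw [h3eq, map_mul, Valuation.map_neg, map_pow, map_pow, hvζ, one_pow, one_mul, hvl,
      ← WithZero.exp_nsmul, WithZero.exp_inj] at h
    simp only [smul_neg, nsmul_eq_mul, Nat.cast_ofNat, neg_inj] at h
    linarith
  have he6' : w.ramificationIdx ℤ = 6 := by
    have hle := Nat.le_of_dvd (by norm_num) he6
    have hpos : 0 < w.ramificationIdx ℤ := Nat.pos_of_dvd_of_pos (dvd_refl _) (Nat.pos_of_ne_zero
      (fun h => by rw [h] at he6; norm_num at he6))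
    omega
  have ht3 : t = 3 := by omega
  rw [he6'] at hv3
  rw [ht3] at hvl
  have hItopG : w.inertia (N ≃ₐ[ℚ] N) = ⊤ :=
    Subgroup.eq_top_of_card_eq _ (by rw [heI, he6', hG6])
  have hprimes := (inertiaDeg_eq_one_of_inertia_eq_top N (N ≃ₐ[ℚ] N) w hItopG).2
  have huniq : ∀ v' : HeightOneSpectrum (𝓞 N), (3 : 𝓞 N) ∈ v'.asIdeal → v' = v := by
    intro v' h3
    haveI := v'.isMaximal
    have hunder' : v'.asIdeal.under ℤ = P3 :=
      Honda1971.under_int_eq_span Nat.prime_three v' (by exact_mod_cast h3)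
    have hmem' : v'.asIdeal ∈ (w.under ℤ).primesOver (𝓞 N) :=
      ⟨v'.isPrime, ⟨by rw [hunder', hunder]⟩⟩
    rw [hprimes, Set.mem_singleton_iff] at hmem'
    exact HeightOneSpectrum.ext hmem'
  obtain ⟨n, hn⟩ : ∃ n : ℕ, n = p * q := ⟨_, rfl⟩
  have hcuben : ∀ b : ℚ, b ^ 3 ≠ (n : ℚ) := hn ▸ Honda1971.pow_three_ne hp hq hpq
  rw [← hn] at h9 hθ'3
  obtain ⟨m, θ₀, hm9, hcube, hθ₀⟩ : ∃ (m : ℤ) (θ₀ : 𝓞 N), (9 : ℤ) ∣ m - 1 ∧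
      (∀ b : ℚ, b ^ 3 ≠ (m : ℚ)) ∧ θ₀ ^ 3 = (m : 𝓞 N) := by
    rcases h9 with h | h
    · refine ⟨(n : ℤ), θ', by omega, fun b hb => hcuben b ?_, ?_⟩
      · rw [hb, Int.cast_natCast]
      · rw [hθ'3, Int.cast_natCast]
    · refine ⟨-(n : ℤ), -θ', by omega, fun b hb => hcuben (-b) ?_, ?_⟩
      · rw [neg_pow, hb, Int.cast_neg, Int.cast_natCast]; ring
      · rw [neg_pow, hθ'3, Int.cast_neg, Int.cast_natCast]; ring
  obtain ⟨θ₁, hθ₁, hle⟩ :=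
    unrOut_exists_cubeRoot_val_le v hζ'2 hm9 hcube hθ₀ hv3 hvl
  exact unrOut_false_of_val_le hcube v huniq hθ₁ hle

end Summit.QuantumAdvantage.QuantumAdvantage.Theorems.LinnikCubicClassGroups

end
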